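import Mathlib
import Summits.NavierStokesRegularity.NavierStokesRegularity.Theorems.ThreadingFluxHorizonTowerDefs
import Summits.NavierStokesRegularity.NavierStokesRegularity.Theorems.ThreadingFluxHorizonTowerTwoShellBracketByName
import Summits.NavierStokesRegularity.NavierStokesRegularity.Theorems.ThreadingFluxHorizonTowerOrderOneSphereEuler
import Summits.NavierStokesRegularity.NavierStokesRegularity.Theorems.ThreadingFluxHorizonTowerProfileFormulas
import Summits.NavierStokesRegularity.NavierStokesRegularity.Theorems.ThreadingFluxHorizonTowerProfileCore
import Summits.NavierStokesRegularity.NavierStokesRegularity.Theorems.ThreadingFluxHorizonTowerTailRung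
import Summits.NavierStokesRegularity.NavierStokesRegularity.Theorems.ThreadingFluxHorizonTowerZonalForm
import Literature.Analysis.FluidPDE.VorticityCalculus
import HarnessLib

/-!
# Crux `PoloidalLiouville` (stmt-NavierStokesRegularity-1222), crux idea «horizon-threading-tower» (ns-idea-15):
# `HorizonTower.TwoShellHorizonTowerZonality` BY NAME — two-shell towers are decided at ORDER ONE

Support file (`--supports stmt-NavierStokesRegularity-1222`, helper; cell `ns-wall-extremal`, width hand ns-wall-eng-3 g3; 0 kit).

THE BRIDGE.  For the two-shell scale-free tower `U = U_A + U_B`, `U_H = horizonProfile · H 0` (`A ∈ 𝓗_l`, `B ∈ 𝓗_m`, `l, m ≥ 1`),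
the order-one horizon law is computed from `OrderOneSphereEuler` (theorem `orderOneSphereEuler`) with radial part
`f = l(l+1)A/rˡ + m(m+1)B/rᵐ` and tangential potential `Φ = 2A/rˡ + 2B/rᵐ` (conjuncts (4)–(5) of `HorizonProfileStructure`,
theorems `horizonProfile_eq_split`, `laplacian_tangentialPotential`):
`⟪x, ∇f(x) × ∇Φ(x)⟫ = 2 (l(l+1) − m(m+1)) (‖x‖²)^{−l/2} (‖x‖²)^{−m/2} ⟪x, ∇A(x) × ∇B(x)⟫` (`x ≠ 0`), hence
`𝔏₁[U] ≡ 0` off the centre forces `⟪x, ∇A × ∇B⟫ ≡ 0` when `l ≠ m` (`inner_cross_gradient_eq_zero_of_horizonL1_twoShell`), and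
`TwoShellBracketZonality` (theorem `twoShellBracketZonality`, from `Zonal.mixedDegreeBracketRigidity`) gives the common axis:
★ `twoShellHorizonTowerZonality : TwoShellHorizonTowerZonality` — the TWO-SHELL CASE of the conjecture `HorizonTowerZonality`
decided by the order-one law alone.

HONEST LABEL: vector calculus + finite-dimensional algebra about one crux idea's typed objects; `HorizonTowerZonality` (general
towers) OPEN, `PoloidalLiouville` (1222) OPEN; NS regularity NOT proved.
-/

-- the summit and its single sub-problem share the name (CONVENTIONS §1)
set_option linter.dupNamespace false

noncomputable section

namespace Summit.NavierStokesRegularity.NavierStokesRegularity.Theorems.PoloidalLiouville.HorizonTower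

open Set Function Filter Topology Metric
open scoped Topology RealInnerProductSpace Laplacian ContDiff
open Literature.Analysis.FluidPDE
open Literature.Geometry.DiscreteGeometry (inner_fin3)

section TwoShell

variable {l : ℕ} {H : E3 → ℝ}

/-- `c·H(z)/‖z‖ˡ = (c·H(z))·(‖z‖²)^{−l/2}` off the origin. -/
theorem const_mul_div_norm_pow_eq_rpow (c : ℝ) {z : E3} (hz : z ≠ 0) :
    c * H z / ‖z‖ ^ l = (c * H z) * (‖z‖ ^ 2) ^ (-(l : ℝ) / 2) := by
  have hr : 0 < ‖z‖ := norm_pos_iff.2 hz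
  have h1 : (‖z‖ ^ 2) ^ (-(l : ℝ) / 2) = (‖z‖ ^ l)⁻¹ := by
    rw [← Real.rpow_natCast ‖z‖ 2, ← Real.rpow_mul hr.le, ← Real.rpow_natCast ‖z‖ l, ← Real.rpow_neg hr.le]
    congr 1; push_cast; ring
  rw [h1, div_eq_mul_inv]

/-- `z ↦ c·H(z)/‖z‖ˡ` agrees near `x ≠ 0` with the `rpow` form. -/
theorem const_mul_div_norm_pow_eventuallyEq (c : ℝ) {x : E3} (hx : x ≠ 0) :
    (fun z : E3 => c * H z / ‖z‖ ^ l) =ᶠ[𝓝 x] fun z => (c * H z) * (‖z‖ ^ 2) ^ (-(l : ℝ) / 2) := by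
  filter_upwards [isOpen_compl_singleton.mem_nhds hx] with z hz using const_mul_div_norm_pow_eq_rpow c hz

/-- `z ↦ c·H(z)/‖z‖ˡ` is smooth off the origin (`H` smooth). -/
theorem contDiffAt_const_mul_div_norm_pow (hH : ContDiff ℝ (⊤ : ℕ∞) H) (c : ℝ) {x : E3} (hx : x ≠ 0)
    {n : WithTop ℕ∞} (hn : n ≤ (⊤ : ℕ∞)) :
    ContDiffAt ℝ n (fun z : E3 => c * H z / ‖z‖ ^ l) x := by
  refine ContDiffAt.congr_of_eventuallyEq ?_ (const_mul_div_norm_pow_eventuallyEq c hx)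
  exact (contDiffAt_const.mul (hH.of_le hn).contDiffAt).mul (contDiffAt_rpow_normSq hx _)

/-- `∇(c·H)(x) = c · ∇H(x)`. -/
theorem gradient_const_mul' {x : E3} (hH : DifferentiableAt ℝ H x) (c : ℝ) :
    gradient (fun z : E3 => c * H z) x = c • gradient H x := by
  apply ext_inner_right ℝ; intro v
  rw [Literature.Analysis.FluidPDE.inner_gradient_left, real_inner_smul_left,
    Literature.Analysis.FluidPDE.inner_gradient_left, fderiv_const_mul hH]
  simp

/-- **Gradient of `c·H/rˡ` off the origin**:
`∇(cH/rˡ)(x) = c (‖x‖²)^{−l/2} ∇H(x) + (2 (−l/2) (‖x‖²)^{−l/2−1} c H(x)) x`. -/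
theorem gradient_const_mul_div_norm_pow (hH : ContDiff ℝ (⊤ : ℕ∞) H) (c : ℝ) {x : E3} (hx : x ≠ 0) :
    gradient (fun z : E3 => c * H z / ‖z‖ ^ l) x
      = (c * (‖x‖ ^ 2) ^ (-(l : ℝ) / 2)) • gradient H x
        + (2 * ((-(l : ℝ) / 2) * (‖x‖ ^ 2) ^ (-(l : ℝ) / 2 - 1)) * (c * H x)) • x := by
  have hHd : DifferentiableAt ℝ H x := (hH.differentiable (by simp)).differentiableAt
  have hcH : DifferentiableAt ℝ (fun z : E3 => c * H z) x := hHd.const_mul c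
  have h1 : gradient (fun z : E3 => c * H z / ‖z‖ ^ l) x
      = gradient (fun z : E3 => (c * H z) * (‖z‖ ^ 2) ^ (-(l : ℝ) / 2)) x := by
    unfold gradient; rw [(const_mul_div_norm_pow_eventuallyEq c hx).fderiv_eq]
  rw [h1, gradient_mul_rpow_normSq hx hcH (-(l : ℝ) / 2) (H := fun z => c * H z), gradient_const_mul' hHd c, smul_smul,
    mul_comm ((‖x‖ ^ 2) ^ (-(l : ℝ) / 2)) c]

/-- **Euler for the tangential potential**: `⟪∇(cH/rˡ)(x), x⟫ = 0` off the origin (`H` homogeneous of degree `l`: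
the quotient is degree-0 homogeneous). -/
theorem inner_gradient_const_mul_div_norm_pow_self (hH : ContDiff ℝ (⊤ : ℕ∞) H)
    (hhom : ∀ (c : ℝ) (y : E3), H (c • y) = c ^ l * H y) (c : ℝ) {x : E3} (hx : x ≠ 0) :
    ⟪gradient (fun z : E3 => c * H z / ‖z‖ ^ l) x, x⟫ = 0 := by
  have hHd : DifferentiableAt ℝ H x := (hH.differentiable (by simp)).differentiableAt
  have hr2 : 0 < ‖x‖ ^ 2 := by positivity
  have hE : ⟪gradient H x, x⟫ = (l : ℝ) * H x := by
    rw [Literature.Analysis.FluidPDE.inner_gradient_left, fderiv_apply_self_of_homogeneous_nat hHd hhom]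
  have hpow : (‖x‖ ^ 2) ^ (-(l : ℝ) / 2 - 1) * ‖x‖ ^ 2 = (‖x‖ ^ 2) ^ (-(l : ℝ) / 2) := by
    rw [Real.rpow_sub_one hr2.ne', div_mul_cancel₀ _ hr2.ne']
  rw [gradient_const_mul_div_norm_pow hH c hx, inner_add_left, real_inner_smul_left, real_inner_smul_left,
    real_inner_self_eq_norm_sq, hE]
  have : 2 * (-(l : ℝ) / 2 * (‖x‖ ^ 2) ^ (-(l : ℝ) / 2 - 1)) * (c * H x) * ‖x‖ ^ 2
      = -(l : ℝ) * c * H x * ((‖x‖ ^ 2) ^ (-(l : ℝ) / 2 - 1) * ‖x‖ ^ 2) := by ring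
  rw [this, hpow]; ring

/-- The tangential quotient `cH/rˡ` is degree-0 homogeneous under positive dilations. -/
theorem const_mul_div_norm_pow_smul (hhom : ∀ (c : ℝ) (y : E3), H (c • y) = c ^ l * H y) (c : ℝ) {a : ℝ}
    (ha : 0 < a) (y : E3) : c * H (a • y) / ‖a • y‖ ^ l = c * H y / ‖y‖ ^ l := by
  rw [hhom, norm_smul, Real.norm_of_nonneg ha.le, mul_pow, mul_left_comm c, mul_div_mul_left _ _ (pow_ne_zero _ ha.ne')]

/-- **Radial part of one shell**: `⟪U_H(x), x⟫ / ‖x‖ = l(l+1) H(x)/‖x‖ˡ` off the origin. -/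
theorem inner_horizonProfile_self_div_norm (hl : 1 ≤ l) (hH : ContDiff ℝ (⊤ : ℕ∞) H)
    (hhom : ∀ (c : ℝ) (y : E3), H (c • y) = c ^ l * H y) (hharm : ∀ y, Laplacian.laplacian H y = 0)
    {x : E3} (hx : x ≠ 0) :
    ⟪horizonProfile l H 0 x, x⟫ / ‖x‖ = (l * (l + 1) : ℝ) * H x / ‖x‖ ^ l := by
  have hr : 0 < ‖x‖ := norm_pos_iff.2 hx
  have hΦ := inner_gradient_const_mul_div_norm_pow_self hH hhom 2 hx
  rw [horizonProfile_eq_split hl hH hhom hharm hx, inner_add_left, real_inner_smul_left, real_inner_smul_left,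
    real_inner_self_eq_norm_sq, hΦ, mul_zero, add_zero]
  field_simp

variable {m : ℕ} {A B : E3 → ℝ}

/-- ★ **THE ORDER-ONE BRIDGE.**  For the two-shell tower `U = U_A + U_B` and `x ≠ 0`:
`⟪x, ∇f(x) × ∇Φ(x)⟫ = 2 (l(l+1) − m(m+1)) (‖x‖²)^{−l/2} (‖x‖²)^{−m/2} ⟪x, ∇A(x) × ∇B(x)⟫` with `f = l(l+1)A/rˡ + m(m+1)B/rᵐ`,
`Φ = 2A/rˡ + 2B/rᵐ` — pure vector algebra once the two gradients are split into their `∇H` and radial parts. -/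
theorem inner_cross_gradient_radial_tangential (hA : ContDiff ℝ (⊤ : ℕ∞) A) (hB : ContDiff ℝ (⊤ : ℕ∞) B) {x : E3}
    (hx : x ≠ 0) :
    ⟪x, cross (gradient ((fun z : E3 => (l * (l + 1) : ℝ) * A z / ‖z‖ ^ l) + fun z : E3 => (m * (m + 1) : ℝ) * B z / ‖z‖ ^ m) x)
        (gradient ((fun z : E3 => 2 * A z / ‖z‖ ^ l) + fun z : E3 => 2 * B z / ‖z‖ ^ m) x)⟫
      = 2 * ((l * (l + 1) : ℝ) - m * (m + 1)) * (‖x‖ ^ 2) ^ (-(l : ℝ) / 2) * (‖x‖ ^ 2) ^ (-(m : ℝ) / 2)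
          * ⟪x, cross (gradient A x) (gradient B x)⟫ := by
  have hdA : ∀ c : ℝ, DifferentiableAt ℝ (fun z : E3 => c * A z / ‖z‖ ^ l) x := fun c =>
    (contDiffAt_const_mul_div_norm_pow hA c hx (n := 1) (by norm_cast)).differentiableAt (by simp)
  have hdB : ∀ c : ℝ, DifferentiableAt ℝ (fun z : E3 => c * B z / ‖z‖ ^ m) x := fun c =>
    (contDiffAt_const_mul_div_norm_pow hB c hx (n := 1) (by norm_cast)).differentiableAt (by simp)
  have hgf : gradient ((fun z : E3 => (l * (l + 1) : ℝ) * A z / ‖z‖ ^ l) + fun z : E3 => (m * (m + 1) : ℝ) * B z / ‖z‖ ^ m) x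
      = gradient (fun z : E3 => (l * (l + 1) : ℝ) * A z / ‖z‖ ^ l) x
        + gradient (fun z : E3 => (m * (m + 1) : ℝ) * B z / ‖z‖ ^ m) x := by
    apply ext_inner_right ℝ; intro v
    rw [inner_add_left, Literature.Analysis.FluidPDE.inner_gradient_left, Literature.Analysis.FluidPDE.inner_gradient_left,
      Literature.Analysis.FluidPDE.inner_gradient_left, fderiv_add (hdA _) (hdB _)]
    rfl
  have hgΦ : gradient ((fun z : E3 => 2 * A z / ‖z‖ ^ l) + fun z : E3 => 2 * B z / ‖z‖ ^ m) x
      = gradient (fun z : E3 => 2 * A z / ‖z‖ ^ l) x + gradient (fun z : E3 => 2 * B z / ‖z‖ ^ m) x := by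
    apply ext_inner_right ℝ; intro v
    rw [inner_add_left, Literature.Analysis.FluidPDE.inner_gradient_left, Literature.Analysis.FluidPDE.inner_gradient_left,
      Literature.Analysis.FluidPDE.inner_gradient_left, fderiv_add (hdA _) (hdB _)]
    rfl
  rw [hgf, hgΦ, gradient_const_mul_div_norm_pow hA _ hx, gradient_const_mul_div_norm_pow hB _ hx,
    gradient_const_mul_div_norm_pow hA _ hx, gradient_const_mul_div_norm_pow hB _ hx]
  -- coordinates
  set ga := gradient A x with hga
  set gb := gradient B x with hgb
  set ρa : ℝ := (‖x‖ ^ 2) ^ (-(l : ℝ) / 2) with hρa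
  set ρb : ℝ := (‖x‖ ^ 2) ^ (-(m : ℝ) / 2) with hρb
  set σa : ℝ := (‖x‖ ^ 2) ^ (-(l : ℝ) / 2 - 1) with hσa
  set σb : ℝ := (‖x‖ ^ 2) ^ (-(m : ℝ) / 2 - 1) with hσb
  set P := ((l * (l + 1) : ℝ) * ρa) • ga + (2 * ((-(l : ℝ) / 2) * σa) * ((l * (l + 1) : ℝ) * A x)) • x
    + (((m * (m + 1) : ℝ) * ρb) • gb + (2 * ((-(m : ℝ) / 2) * σb) * ((m * (m + 1) : ℝ) * B x)) • x) with hP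
  set Q := ((2 : ℝ) * ρa) • ga + (2 * ((-(l : ℝ) / 2) * σa) * (2 * A x)) • x
    + (((2 : ℝ) * ρb) • gb + (2 * ((-(m : ℝ) / 2) * σb) * (2 * B x)) • x) with hQ
  obtain ⟨p0, p1, p2⟩ := cross_fin3 P Q
  obtain ⟨q0, q1, q2⟩ := cross_fin3 ga gb
  rw [inner_fin3, inner_fin3, p0, p1, p2, q0, q1, q2]
  simp only [hP, hQ, PiLp.add_apply, PiLp.smul_apply, smul_eq_mul]
  ring

/-- `l(l+1) ≠ m(m+1)` for natural numbers `l ≠ m`. -/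
theorem mul_succ_ne_of_ne (hlm : l ≠ m) : ((l * (l + 1) : ℝ) - m * (m + 1)) ≠ 0 := by
  have h : ((l * (l + 1) : ℝ) - m * (m + 1)) = ((l : ℝ) - m) * ((l : ℝ) + m + 1) := by ring
  rw [h]
  refine mul_ne_zero ?_ ?_
  · exact sub_ne_zero.2 (by exact_mod_cast hlm)
  · positivity

/-- ★★ **Order-one law of a two-shell tower forces the bracket to vanish.**  If `𝔏₁[U_A + U_B] ≡ 0` off the centre for the
horizon profiles of smooth homogeneous harmonic `A` (degree `l`), `B` (degree `m`), `l ≠ m`, `l, m ≥ 1`, then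
`⟪x, ∇A(x) × ∇B(x)⟫ = 0` for every `x`. -/
theorem inner_cross_gradient_eq_zero_of_horizonL1_twoShell (hl : 1 ≤ l) (hm : 1 ≤ m) (hlm : l ≠ m)
    (hA : ContDiff ℝ (⊤ : ℕ∞) A) (hhomA : ∀ (c : ℝ) (y : E3), A (c • y) = c ^ l * A y)
    (hharmA : ∀ y, Laplacian.laplacian A y = 0)
    (hB : ContDiff ℝ (⊤ : ℕ∞) B) (hhomB : ∀ (c : ℝ) (y : E3), B (c • y) = c ^ m * B y)
    (hharmB : ∀ y, Laplacian.laplacian B y = 0)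
    (hL1 : ∀ x : E3, x ≠ 0 → horizonL1 (fun z => horizonProfile l A 0 z + horizonProfile m B 0 z) 0 x = 0) (x : E3) :
    ⟪x, cross (gradient A x) (gradient B x)⟫ = 0 := by
  classical
  by_cases hx : x = 0
  · rw [hx, inner_zero_left]
  -- the data of `OrderOneSphereEuler`
  set U : E3 → E3 := fun z => horizonProfile l A 0 z + horizonProfile m B 0 z with hU
  set f : E3 → ℝ := (fun z : E3 => (l * (l + 1) : ℝ) * A z / ‖z‖ ^ l) + fun z : E3 => (m * (m + 1) : ℝ) * B z / ‖z‖ ^ m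
    with hf
  set Φ : E3 → ℝ := (fun z : E3 => 2 * A z / ‖z‖ ^ l) + fun z : E3 => 2 * B z / ‖z‖ ^ m with hΦ
  have hUA : ∀ {z : E3}, z ≠ 0 → ContDiffAt ℝ (⊤ : ℕ∞) (horizonProfile l A 0) z := fun hz =>
    contDiffAt_horizonProfile hl hA hhomA hharmA hz
  have hUB : ∀ {z : E3}, z ≠ 0 → ContDiffAt ℝ (⊤ : ℕ∞) (horizonProfile m B 0) z := fun hz =>
    contDiffAt_horizonProfile hm hB hhomB hharmB hz
  have hUAd : ∀ {z : E3}, z ≠ 0 → DifferentiableAt ℝ (horizonProfile l A 0) z := fun hz =>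
    (hUA hz).differentiableAt (by simp)
  have hUBd : ∀ {z : E3}, z ≠ 0 → DifferentiableAt ℝ (horizonProfile m B 0) z := fun hz =>
    (hUB hz).differentiableAt (by simp)
  -- (1) smoothness off the centre
  have h1 : ContDiffOn ℝ (⊤ : ℕ∞) U {(0 : E3)}ᶜ := fun z hz =>
    ((hUA (by simpa using hz)).add (hUB (by simpa using hz))).contDiffWithinAt
  have h2 : ContDiffOn ℝ (⊤ : ℕ∞) Φ {(0 : E3)}ᶜ := fun z hz =>
    ((contDiffAt_const_mul_div_norm_pow hA 2 (by simpa using hz) le_rfl).add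
      (contDiffAt_const_mul_div_norm_pow hB 2 (by simpa using hz) le_rfl)).contDiffWithinAt
  -- (2) degree-0 homogeneity
  have h3 : IsZeroHomogeneousAbout 0 U := by
    intro c hc y
    have eA := isZeroHomogeneousAbout_horizonProfile hl hA hhomA c hc y
    have eB := isZeroHomogeneousAbout_horizonProfile hm hB hhomB c hc y
    simp only [hU, eA, eB]
  have h4 : ∀ c : ℝ, 0 < c → ∀ y : E3, Φ (0 + c • y) = Φ (0 + y) := by
    intro c hc y
    simp only [hΦ, Pi.add_apply, zero_add, const_mul_div_norm_pow_smul hhomA 2 hc, const_mul_div_norm_pow_smul hhomB 2 hc]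
  -- (3) divergence free and unthreaded off the centre
  have h5 : ∀ z : E3, z ≠ 0 → VectorCalculus.divergence U z = 0 := by
    intro z hz
    have hadd : VectorCalculus.divergence U z
        = VectorCalculus.divergence (horizonProfile l A 0) z + VectorCalculus.divergence (horizonProfile m B 0) z := by
      simp only [hU, VectorCalculus.divergence]
      rw [fderiv_fun_add (hUAd hz) (hUBd hz), ContinuousLinearMap.toLinearMap_add, map_add]
    rw [hadd, divergence_horizonProfile hl hA hz, divergence_horizonProfile hm hB hz, add_zero]
  have h6 : ∀ z : E3, z ≠ 0 → ⟪curl U z, z - 0⟫ = 0 := by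
    intro z hz
    rw [sub_zero, hU, curl_add (hUAd hz) (hUBd hz), inner_add_left, inner_curl_horizonProfile hl hA hhomA hz,
      inner_curl_horizonProfile hm hB hhomB hz, add_zero]
  -- (4) the radial part and the tangential potential
  have h7 : ∀ z : E3, z ≠ 0 → f z = ⟪U z, z - 0⟫ / ‖z - 0‖ := by
    intro z hz
    rw [sub_zero, hU]
    simp only [hf, Pi.add_apply]
    rw [inner_add_left, add_div, inner_horizonProfile_self_div_norm hl hA hhomA hharmA hz,
      inner_horizonProfile_self_div_norm hm hB hhomB hharmB hz]
  have h8 : ∀ z : E3, z ≠ 0 → ‖z - 0‖ ^ 2 * Laplacian.laplacian Φ z = -2 * f z := by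
    intro z hz
    have cA : ContDiffAt ℝ 2 (fun w : E3 => 2 * A w / ‖w‖ ^ l) z :=
      contDiffAt_const_mul_div_norm_pow hA 2 hz (by norm_cast)
    have cB : ContDiffAt ℝ 2 (fun w : E3 => 2 * B w / ‖w‖ ^ m) z :=
      contDiffAt_const_mul_div_norm_pow hB 2 hz (by norm_cast)
    rw [sub_zero, hΦ, cA.laplacian_add cB, mul_add, laplacian_tangentialPotential hA hhomA hharmA hz,
      laplacian_tangentialPotential hB hhomB hharmB hz]
    simp only [hf, Pi.add_apply]
    ring
  -- (5) the order-one law as a bracket, and the bridge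
  have hSE := orderOneSphereEuler U f Φ 0 h1 h2 h3 h4 h5 h6 h7 h8 x hx
  rw [hL1 x hx, sub_zero] at hSE
  have hr : 0 < ‖x‖ := norm_pos_iff.2 hx
  have hzero : ⟪x, cross (gradient f x) (gradient Φ x)⟫ = 0 := by
    have := hSE.symm
    rw [neg_mul, neg_eq_zero, mul_eq_zero] at this
    exact this.resolve_left hr.ne'
  rw [hf, hΦ, inner_cross_gradient_radial_tangential hA hB hx] at hzero
  have hρa : 0 < (‖x‖ ^ 2) ^ (-(l : ℝ) / 2) := Real.rpow_pos_of_pos (by positivity) _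
  have hρb : 0 < (‖x‖ ^ 2) ^ (-(m : ℝ) / 2) := Real.rpow_pos_of_pos (by positivity) _
  have hc : 2 * ((l * (l + 1) : ℝ) - m * (m + 1)) * (‖x‖ ^ 2) ^ (-(l : ℝ) / 2) * (‖x‖ ^ 2) ^ (-(m : ℝ) / 2) ≠ 0 :=
    mul_ne_zero (mul_ne_zero (mul_ne_zero two_ne_zero (mul_succ_ne_of_ne hlm)) hρa.ne') hρb.ne'
  exact (mul_eq_zero.1 hzero).resolve_left hc

end TwoShell

/-- ★★★ `TwoShellHorizonTowerZonality` BY NAME — the TWO-SHELL CASE of the conjecture `HorizonTowerZonality`, decided at ORDER ONE: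
a scale-free two-shell tower of nonzero solid harmonics of different degrees annihilated by `𝔏₁` off the centre is axisymmetric
without swirl (both shells zonal about one common axis). -/
theorem twoShellHorizonTowerZonality : TwoShellHorizonTowerZonality := by
  intro l m A B hl hm hlm hA hhomA hharmA hB hhomB hharmB hA0 hB0 hL1
  exact twoShellBracketZonality l m A B hl hm hlm hA hhomA hharmA hB hhomB hharmB hA0 hB0
    (inner_cross_gradient_eq_zero_of_horizonL1_twoShell hl hm hlm hA hhomA hharmA hB hhomB hharmB hL1)

/-- ★ The same in the LITERAL conclusion shape of `HorizonTowerZonality` (l.261 of the Defs twin): under the order-one law alone,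
the radial part `⟪U(x), x − x₀⟫` of the two-shell tower (`x₀ = 0`) has the zonal form `‖x‖·g(⟪a, x⟫/‖x‖)` — here with the explicit
profile `g = l(l+1)·g_A + m(m+1)·g_B`. -/
theorem twoShell_radialPart_zonal (l m : ℕ) (A B : E3 → ℝ) (hl : 1 ≤ l) (hm : 1 ≤ m) (hlm : l ≠ m)
    (hA : ContDiff ℝ (⊤ : ℕ∞) A) (hhomA : ∀ (c : ℝ) (y : E3), A (c • y) = c ^ l * A y)
    (hharmA : ∀ y, Laplacian.laplacian A y = 0)
    (hB : ContDiff ℝ (⊤ : ℕ∞) B) (hhomB : ∀ (c : ℝ) (y : E3), B (c • y) = c ^ m * B y)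
    (hharmB : ∀ y, Laplacian.laplacian B y = 0) (hA0 : ∃ y, A y ≠ 0) (hB0 : ∃ y, B y ≠ 0)
    (hL1 : ∀ x : E3, x ≠ 0 → horizonL1 (fun z => horizonProfile l A 0 z + horizonProfile m B 0 z) 0 x = 0) :
    ∃ (a : E3) (g : ℝ → ℝ), a ≠ 0 ∧ ∀ x : E3, x ≠ 0 →
      ⟪horizonProfile l A 0 x + horizonProfile m B 0 x, x - 0⟫ = ‖x - 0‖ * g (⟪a, x - 0⟫ / ‖x - 0‖) := by
  obtain ⟨a, gA, gB, ha, hgA, hgB⟩ :=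
    twoShellHorizonTowerZonality l m A B hl hm hlm hA hhomA hharmA hB hhomB hharmB hA0 hB0 hL1
  refine ⟨a, fun s => (l * (l + 1) : ℝ) * gA s + (m * (m + 1) : ℝ) * gB s, ha, fun x hx => ?_⟩
  have hr : (‖x‖ : ℝ) ≠ 0 := norm_ne_zero_iff.2 hx
  have hrl : (‖x‖ ^ l : ℝ) ≠ 0 := pow_ne_zero _ hr
  have hrm : (‖x‖ ^ m : ℝ) ≠ 0 := pow_ne_zero _ hr
  have eA := inner_horizonProfile_self_div_norm hl hA hhomA hharmA hx
  have eB := inner_horizonProfile_self_div_norm hm hB hhomB hharmB hx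
  rw [div_eq_iff hr] at eA eB
  have qA : A x / ‖x‖ ^ l = gA (⟪a, x⟫ / ‖x‖) := by rw [hgA x hx, mul_div_cancel_left₀ _ hrl]
  have qB : B x / ‖x‖ ^ m = gB (⟪a, x⟫ / ‖x‖) := by rw [hgB x hx, mul_div_cancel_left₀ _ hrm]
  rw [sub_zero, inner_add_left, eA, eB]
  beta_reduce
  rw [← qA, ← qB]
  ring

end Summit.NavierStokesRegularity.NavierStokesRegularity.Theorems.PoloidalLiouville.HorizonTower

end
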